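import Summits.CriticalPhenomena.PercolationContinuityZ3.Theorems.PercNearOneGluingNoHeavyLowerTailSunflowerRainbowKernel
import HarnessLib
import HarnessLib.Audit

/-!
# `NoHeavyLowerTail` (crux stmt-CriticalPhenomena-4575), abstract sunflower cubic: ★ (`PartitionLemmaH`) REDUCED TO THE LINEAR INDEPENDENCE OF
# AN EXPLICIT FAMILY OF GF(2) VECTORS, part A — the spectator rows and the two-stage rainbow vectors (definitions), and
# `specRows_indep` (the spectator rows are linearly independent)

Support file (seat `prim-l12-p2` gen 18; `--supports stmt-CriticalPhenomena-4575`).  No `sorry`.  Definitions: `Sunflower.IsRainbow`, `Sunflower.specRow`,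
`Sunflower.rbVec` (the vectors of the GF(2) programme; part B `…SunflowerRainbowReduction` states the typed conjecture and proves the reduction).
Memo: run/shared/lean/prim/prim-l12/prim-l12-p2/FINDING-g18-CUBE-GLADKOV-RANK.md §8.

SETTING.  `F : Sunflower α`; `F.dem`, `F.sup` (`…SunflowerStarMatching`, spectator-left orientation): demands `d = (S, X)` with third block
`Y = (S ∪ X)ᶜ` and word `(lab S, lab X, lab Y) = (x, i, j)`, `x ∈ {0,4}`, petals `i < j` — i.e. `(X|Y)` is a cross pair of the cube `Sᶜ` listed by its
larger side `Y` — or a RAINBOW `(Q1,Q2,Q3)` (word `(1,2,3)`); supplies `σ = (X', S')`, `Y' = (X' ∪ S')ᶜ`, word `(4, 0∨4, 0)`.  ★ ⟺ `#dem ≤ #sup`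
(`ZH = 6(#sup − #dem)`).
THE VECTORS (all in `GF(2)^{sup}`).
* spectator rows `specRow d` (non-rainbow `d`), supported on the supplies with the same spectator block `S' = S`: the cube-theorem row
  `M(Y,Y') = #{R' ∈ B : Y' ⊆ R' ⊆ Y}` if `lab S = 0` (part 2), the dual row `N(Y',Y) = #{R ∈ A : X ⊆ R ⊆ X'}` if `lab S = 4` (part 3);
  they are linearly independent (`specRows_indep`: cube by cube, `cross_kernel_trivial` / `cross_kernel_trivial_dual`).
* rainbow vectors `rbVec ρ = TS-B + TS-A` (the TWO-STAGE vectors of the memo):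
  `TS-B(σ) = [lab S' = 0, S' ⊆ Q3, lab (S'ᶜ ∖ Q1) = 4] · Φ_B(S',Q3) · #{R ∈ A : Q1 ⊆ R ⊆ X'}`,
  `TS-A(σ) = [lab S' = 4, Q1 ⊆ S', Q3 ⊆ S'ᶜ, lab (S'ᶜ ∖ Q3) = 0] · Φ_A(Q1,S') · #{R' ∈ B : Y' ⊆ R' ⊆ Q3}`;
  each is orthogonal to every spectator row (`rbVec_orth`: the kernel lemmas `nu_mem_ker` / `mu_mem_ker` of part 3).
* `RainbowKernelIndependence` (typed conjecture; census: n ≤ 4 exhaustive, 8·10⁴ random sunflowers on 5–6 points, doubled star, perturbed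
  co-products and three-hub families on 7–8 points — 0 exceptions; kit j132962 = n = 5 exhaustive): the `rbVec ρ` are linearly independent.
* `partitionLemmaH_of_rainbowKernelIndependence`: rank–nullity in `GF(2)^{sup}` — the span of the rainbow vectors sits in the kernel of the
  spectator-row map, whose rank is the number of spectator demands; hence `#dem = #spec + #rainbows ≤ #sup`, i.e. `0 ≤ ZH`.
-/

namespace Summit.CriticalPhenomena.PercolationContinuityZ3.Theorems.SunflowerPartition

open Finset

namespace Sunflower

variable {α : Type*} [Fintype α] [DecidableEq α] (F : Sunflower α)

/-! ## The vectors -/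

/-- Rainbow demands: word `(1,2,3)`. [this work] -/
def IsRainbow (d : Finset α × Finset α) : Prop := F.lab d.1 = 1 ∧ F.lab d.2 = 2 ∧ F.lab (d.1 ∪ d.2)ᶜ = 3

/-- `IsRainbow` is decidable. [this work] -/
instance (d : Finset α × Finset α) : Decidable (F.IsRainbow d) := by unfold IsRainbow; infer_instance

/-- The SPECTATOR ROW of a non-rainbow demand `d = (S, X)` (`Y = (S ∪ X)ᶜ`) at the supply `σ = (X', S')` (`Y' = (X' ∪ S')ᶜ`): zero unless `S' = S`;
then `#{R' ∈ B : Y' ⊆ R' ⊆ Y}` if `lab S = 0` and `#{R ∈ A : Sᶜ ∖ Y ⊆ R ⊆ Sᶜ ∖ Y'}` if not (mod 2, sums over the cube `Sᶜ`). [this work] -/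
def specRow (d σ : Finset α × Finset α) : ZMod 2 :=
  if σ.2 = d.1 then
    (if F.lab d.1 = 0 then
      ∑ R' ∈ (d.1ᶜ).powerset, (if F.lab R' = 0 ∧ (σ.1 ∪ σ.2)ᶜ ⊆ R' ∧ R' ⊆ (d.1 ∪ d.2)ᶜ then (1 : ZMod 2) else 0)
     else
      ∑ R ∈ (d.1ᶜ).powerset, (if F.lab R = 4 ∧ d.1ᶜ \ (d.1 ∪ d.2)ᶜ ⊆ R ∧ R ⊆ d.1ᶜ \ (σ.1 ∪ σ.2)ᶜ then (1 : ZMod 2) else 0))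
  else 0

/-- The TWO-STAGE RAINBOW VECTOR of a rainbow `ρ = (Q1, Q2)` (`Q3 = (Q1 ∪ Q2)ᶜ`) at the supply `σ = (X', S')` (`Y' = (X' ∪ S')ᶜ`):
`TS-B + TS-A` (file header). [this work] -/
def rbVec (ρ σ : Finset α × Finset α) : ZMod 2 :=
  (if F.lab σ.2 = 0 ∧ σ.2 ⊆ (ρ.1 ∪ ρ.2)ᶜ ∧ F.lab (σ.2ᶜ \ ρ.1) = 4 then
      (∑ R' ∈ (Finset.univ : Finset α).powerset, (if F.lab R' = 0 ∧ σ.2 ⊆ R' ∧ R' ⊆ (ρ.1 ∪ ρ.2)ᶜ then (1 : ZMod 2) else 0)) *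
      (∑ R ∈ (σ.2ᶜ).powerset, (if F.lab R = 4 ∧ ρ.1 ⊆ R ∧ R ⊆ σ.2ᶜ \ (σ.1 ∪ σ.2)ᶜ then (1 : ZMod 2) else 0))
    else 0)
  + (if F.lab σ.2 = 4 ∧ ρ.1 ⊆ σ.2 ∧ (ρ.1 ∪ ρ.2)ᶜ ⊆ σ.2ᶜ ∧ F.lab (σ.2ᶜ \ (ρ.1 ∪ ρ.2)ᶜ) = 0 then
      (∑ R ∈ (Finset.univ : Finset α).powerset, (if F.lab R = 4 ∧ ρ.1 ⊆ R ∧ R ⊆ σ.2 then (1 : ZMod 2) else 0)) *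
      (∑ R' ∈ (σ.2ᶜ).powerset, (if F.lab R' = 0 ∧ (σ.1 ∪ σ.2)ᶜ ⊆ R' ∧ R' ⊆ (ρ.1 ∪ ρ.2)ᶜ then (1 : ZMod 2) else 0))
    else 0)

/-! ## Bookkeeping on blocks -/

omit [Fintype α] in
/-- Membership in `parts`. [this work] -/
theorem mem_parts_iff' [Fintype α] {q : Finset α × Finset α} : q ∈ parts α ↔ Disjoint q.1 q.2 := by
  unfold parts; simp

/-- For disjoint `S, X`: the third block `(S ∪ X)ᶜ` is `Sᶜ ∖ X`, and `Sᶜ ∖ (S ∪ X)ᶜ = X`. [folklore] -/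
theorem compl_sdiff_third {S X : Finset α} (h : Disjoint S X) : Sᶜ \ (S ∪ X)ᶜ = X := by
  ext x
  simp only [mem_sdiff, mem_compl, mem_union, not_or, not_and, not_not]
  constructor
  · rintro ⟨hxS, hx⟩; exact hx hxS
  · intro hxX; exact ⟨fun hxS => (Finset.disjoint_left.1 h) hxS hxX, fun _ => hxX⟩

/-- For disjoint `S, X`: `(S ∪ X)ᶜ ⊆ Sᶜ`. [folklore] -/
theorem third_subset_compl (S X : Finset α) : (S ∪ X)ᶜ ⊆ Sᶜ := by
  intro x hx
  rw [mem_compl, mem_union, not_or] at hx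
  exact mem_compl.2 hx.1

/-- For `Y ⊆ Sᶜ`: `(S ∪ (Sᶜ ∖ Y))ᶜ = Y`. [folklore] -/
theorem third_of_sdiff {S Y : Finset α} (hY : Y ⊆ Sᶜ) : (S ∪ (Sᶜ \ Y))ᶜ = Y := by
  ext x
  simp only [mem_compl, mem_union, mem_sdiff, not_or, not_and, not_not]
  constructor
  · rintro ⟨hxS, hx⟩; exact hx (by simpa using hxS)
  · intro hxY
    have hxS : x ∉ S := by have := hY hxY; simpa using this
    exact ⟨hxS, fun _ => hxY⟩

/-- Facts read off a non-rainbow demand `d ∈ dem`: blocks disjoint, `lab d.1 ∈ {0,4}`, `lab d.2`, `lab (d.1∪d.2)ᶜ` petals with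
`lab d.2 < lab (d.1∪d.2)ᶜ`. [this work] -/
theorem dem_spec_facts {d : Finset α × Finset α} (hd : d ∈ F.dem) (hnr : ¬ F.IsRainbow d) :
    Disjoint d.1 d.2 ∧ (F.lab d.1 = 0 ∨ F.lab d.1 = 4) ∧ F.lab d.2 ≠ 0 ∧ F.lab d.2 ≠ 4 ∧ F.lab (d.1 ∪ d.2)ᶜ ≠ 0 ∧
      F.lab (d.1 ∪ d.2)ᶜ ≠ 4 ∧ F.lab d.2 < F.lab (d.1 ∪ d.2)ᶜ := by
  unfold Sunflower.dem at hd
  rw [mem_filter] at hd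
  obtain ⟨hp, hw⟩ := hd
  refine ⟨mem_parts_iff'.1 hp, ?_⟩
  unfold IsRainbow at hnr
  revert hw hnr
  generalize F.lab d.1 = x; generalize F.lab d.2 = y; generalize F.lab (d.1 ∪ d.2)ᶜ = z
  unfold demInd
  intro hnr hw
  by_cases h : (x = 1 ∧ y = 2 ∧ z = 3) ∨ ((x = 4 ∨ x = 0) ∧ (y = 1 ∨ y = 2 ∨ y = 3) ∧ (z = 1 ∨ z = 2 ∨ z = 3) ∧ y < z)
  · rcases h with h | ⟨hx, hy, hz, hlt⟩
    · exact absurd h hnr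
    · refine ⟨hx.symm, ?_, ?_, ?_, ?_, hlt⟩ <;> rcases hy with h | h | h <;> rcases hz with h' | h' | h' <;> (subst h; subst h'; decide)
  · rw [if_neg h] at hw; exact absurd hw (by decide)

/-- Facts read off a rainbow demand. [this work] -/
theorem dem_rainbow_facts {d : Finset α × Finset α} (hd : d ∈ F.dem) (hr : F.IsRainbow d) :
    Disjoint d.1 d.2 ∧ F.lab d.1 = 1 ∧ F.lab d.2 = 2 ∧ F.lab (d.1 ∪ d.2)ᶜ = 3 := by
  unfold Sunflower.dem at hd
  exact ⟨mem_parts_iff'.1 (mem_filter.1 hd).1, hr⟩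

/-- Facts read off a supply `σ ∈ sup`. [this work] -/
theorem sup_facts {σ : Finset α × Finset α} (hσ : σ ∈ F.sup) :
    Disjoint σ.1 σ.2 ∧ F.lab σ.1 = 4 ∧ (F.lab σ.2 = 4 ∨ F.lab σ.2 = 0) ∧ F.lab (σ.1 ∪ σ.2)ᶜ = 0 := by
  unfold Sunflower.sup at hσ
  rw [mem_filter] at hσ
  obtain ⟨hp, hw⟩ := hσ
  refine ⟨mem_parts_iff'.1 hp, ?_⟩
  revert hw
  generalize F.lab σ.1 = x; generalize F.lab σ.2 = y; generalize F.lab (σ.1 ∪ σ.2)ᶜ = z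
  unfold supInd
  intro hw
  by_cases h : x = 4 ∧ (y = 4 ∨ y = 0) ∧ z = 0
  · exact h
  · rw [if_neg h] at hw; exact absurd hw (by decide)

/-- The supply with kernel side `Sᶜ ∖ O`, spectator `S` and bottom `O`. [this work] -/
theorem mk_mem_sup {S O : Finset α} (hO : O ⊆ Sᶜ) (hS : F.lab S = 4 ∨ F.lab S = 0) (hO0 : F.lab O = 0) (hX4 : F.lab (Sᶜ \ O) = 4) :
    (Sᶜ \ O, S) ∈ F.sup := by
  unfold Sunflower.sup
  refine mem_filter.2 ⟨mem_parts_iff'.2 ?_, ?_⟩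
  · exact Finset.disjoint_left.2 fun x hx hxS => (mem_compl.1 (mem_sdiff.1 hx).1) hxS
  · have h3 : ((Sᶜ \ O) ∪ S)ᶜ = O := by
      ext x; simp only [mem_compl, mem_union, mem_sdiff, not_or, not_and, not_not]
      constructor
      · rintro ⟨h1, h2⟩; exact h1 h2
      · intro hx; exact ⟨fun _ => hx, fun hxS => (mem_compl.1 (hO hx)) hxS⟩
    show supInd (F.lab (Sᶜ \ O)) (F.lab S) (F.lab ((Sᶜ \ O) ∪ S)ᶜ) = 1
    rw [h3]; unfold supInd; rw [if_pos ⟨hX4, hS, hO0⟩]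

/-- The demand with spectator `S`, smaller side `Sᶜ ∖ Y` and larger side `Y`. [this work] -/
theorem mk_mem_dem {S Y : Finset α} (hY : Y ⊆ Sᶜ) (hS : F.lab S = 4 ∨ F.lab S = 0)
    (hX0 : F.lab (Sᶜ \ Y) ≠ 0) (hX4 : F.lab (Sᶜ \ Y) ≠ 4) (hY0 : F.lab Y ≠ 0) (hY4 : F.lab Y ≠ 4) (hlt : F.lab (Sᶜ \ Y) < F.lab Y) :
    (S, Sᶜ \ Y) ∈ F.dem ∧ ¬ F.IsRainbow (S, Sᶜ \ Y) := by
  have h3 : (S ∪ (Sᶜ \ Y))ᶜ = Y := third_of_sdiff hY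
  constructor
  · unfold Sunflower.dem
    refine mem_filter.2 ⟨mem_parts_iff'.2 ?_, ?_⟩
    · exact Finset.disjoint_left.2 fun x hxS hx => (mem_compl.1 (mem_sdiff.1 hx).1) hxS
    · show demInd (F.lab S) (F.lab (Sᶜ \ Y)) (F.lab (S ∪ (Sᶜ \ Y))ᶜ) = 1
      rw [h3]
      rcases petal_lt_cases _ _ hX0 hX4 hY0 hY4 hlt with ⟨h1, h2 | h2⟩ | ⟨h1, h2⟩ <;> rcases hS with hs | hs <;>
        (unfold demInd; rw [h1, h2, hs]; decide)
  · unfold IsRainbow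
    rintro ⟨h1, -, -⟩
    rcases hS with hs | hs <;> rw [hs] at h1 <;> exact absurd h1 (by decide)

/-! ## The spectator rows are linearly independent -/

/-- **Spectator rows are independent** (this work): if `Σ_d c_d · specRow d = 0` on `sup` (sum over the non-rainbow demands), then `c = 0` there.
Cube by cube: the rows with spectator `S` are the rows of the cube theorem (`lab S = 0`) / of its dual (`lab S = 4`) for the cube `Sᶜ`. [this work] -/
theorem specRows_indep (c : Finset α × Finset α → ZMod 2)
    (hc : ∀ σ ∈ F.sup, (∑ d ∈ F.dem.filter (fun d => ¬ F.IsRainbow d), c d * F.specRow d σ) = 0) :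
    ∀ d ∈ F.dem.filter (fun d => ¬ F.IsRainbow d), c d = 0 := by
  intro d hd
  obtain ⟨hdd, hnr⟩ := mem_filter.1 hd
  obtain ⟨hdisj, hS, hX0, hX4, hY0, hY4, hlt⟩ := F.dem_spec_facts hdd hnr
  set S := d.1 with hSdef
  set W := Sᶜ with hW
  -- the demands with spectator `S`, reindexed by their larger side `Y ⊆ W`
  have hXd : W \ (d.1 ∪ d.2)ᶜ = d.2 := compl_sdiff_third hdisj
  have hYW : (d.1 ∪ d.2)ᶜ ⊆ W := third_subset_compl d.1 d.2
  -- the restricted combination, as a function of `Y`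
  let lam : Finset α → ZMod 2 := fun Y => if (S, W \ Y) ∈ F.dem.filter (fun d => ¬ F.IsRainbow d) then c (S, W \ Y) else 0
  -- key reindexing: for a supply `σ = (W ∖ O, S)`, the full sum equals the cube sum
  have reindex : ∀ O, O ⊆ W → ∀ g : Finset α → ZMod 2,
      (∑ d' ∈ F.dem.filter (fun d => ¬ F.IsRainbow d), c d' * (if S = d'.1 then g (d'.1 ∪ d'.2)ᶜ else 0))
        = ∑ Y ∈ W.powerset.filter (fun Y => F.lab Y ≠ 0 ∧ F.lab Y ≠ 4 ∧ F.lab (W \ Y) ≠ 0 ∧ F.lab (W \ Y) ≠ 4 ∧ F.lab (W \ Y) < F.lab Y),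
            lam Y * g Y := by
    intro O _ g
    -- restrict the left sum to the demands with spectator `S`
    rw [← Finset.sum_filter_add_sum_filter_not (F.dem.filter (fun d => ¬ F.IsRainbow d)) (fun d' => S = d'.1)]
    rw [show (∑ d' ∈ (F.dem.filter (fun d => ¬ F.IsRainbow d)).filter (fun d' => ¬ S = d'.1),
          c d' * (if S = d'.1 then g (d'.1 ∪ d'.2)ᶜ else 0)) = 0 from
        sum_eq_zero fun d' hd' => by rw [if_neg (mem_filter.1 hd').2, mul_zero], add_zero]
    refine Finset.sum_bij' (fun d' _ => (d'.1 ∪ d'.2)ᶜ) (fun Y _ => (S, W \ Y)) ?_ ?_ ?_ ?_ ?_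
    · intro d' hd'
      obtain ⟨hd'f, hSd'⟩ := mem_filter.1 hd'
      obtain ⟨hd'd, hnr'⟩ := mem_filter.1 hd'f
      obtain ⟨hdisj', -, hX0', hX4', hY0', hY4', hlt'⟩ := F.dem_spec_facts hd'd hnr'
      have e : W \ (d'.1 ∪ d'.2)ᶜ = d'.2 := by rw [hW, hSd']; exact compl_sdiff_third hdisj'
      have hsub : (d'.1 ∪ d'.2)ᶜ ⊆ W := by rw [hW, hSd']; exact third_subset_compl d'.1 d'.2
      refine mem_filter.2 ⟨mem_powerset.2 hsub, hY0', hY4', ?_, ?_, ?_⟩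
      · rw [e]; exact hX0'
      · rw [e]; exact hX4'
      · rw [e]; exact hlt'
    · intro Y hY
      obtain ⟨hYW', hY0', hY4', hX0', hX4', hlt'⟩ := mem_filter.1 hY
      have hmem := F.mk_mem_dem (mem_powerset.1 hYW') (hS.symm) hX0' hX4' hY0' hY4' hlt'
      exact mem_filter.2 ⟨mem_filter.2 hmem, rfl⟩
    · intro d' hd'
      obtain ⟨hd'f, hSd'⟩ := mem_filter.1 hd'
      obtain ⟨hd'd, hnr'⟩ := mem_filter.1 hd'f
      obtain ⟨hdisj', -⟩ := F.dem_spec_facts hd'd hnr'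
      have e : W \ (d'.1 ∪ d'.2)ᶜ = d'.2 := by rw [hW, hSd']; exact compl_sdiff_third hdisj'
      rw [e]
      rcases d' with ⟨a, b⟩
      simp only at hSd' ⊢
      rw [hSd']
    · intro Y hY
      obtain ⟨hYW', -⟩ := mem_filter.1 hY
      exact third_of_sdiff (mem_powerset.1 hYW')
    · intro d' hd'
      obtain ⟨hd'f, hSd'⟩ := mem_filter.1 hd'
      obtain ⟨hd'd, hnr'⟩ := mem_filter.1 hd'f
      obtain ⟨hdisj', -⟩ := F.dem_spec_facts hd'd hnr'
      have e : W \ (d'.1 ∪ d'.2)ᶜ = d'.2 := by rw [hW, hSd']; exact compl_sdiff_third hdisj'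
      rw [if_pos hSd']
      have hd'eq : (S, W \ (d'.1 ∪ d'.2)ᶜ) = d' := by
        rw [e]; rcases d' with ⟨a, b⟩; simp only at hSd' ⊢; rw [hSd']
      simp only [lam]
      rw [hd'eq, if_pos hd'f]
  -- conclude with the cube theorem on `W = Sᶜ`
  have hlam : lam (d.1 ∪ d.2)ᶜ = c d := by
    simp only [lam]
    rw [hXd, show (S, d.2) = d from rfl, if_pos hd]
  rw [← hlam]
  rcases hS with hS0 | hS4
  · -- bottom spectator: `M`-rows
    refine F.cross_kernel_trivial W lam ?_ (d.1 ∪ d.2)ᶜ (mem_filter.2 ⟨mem_powerset.2 hYW, hY0, hY4, hXd.symm ▸ hX0, hXd.symm ▸ hX4, hXd.symm ▸ hlt⟩)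
    intro O hO hO0 hO4
    have hOW := mem_powerset.1 hO
    have hσ : (W \ O, S) ∈ F.sup := F.mk_mem_sup hOW (Or.inr hS0) hO0 hO4
    have h := hc _ hσ
    have h3 : ((W \ O) ∪ S)ᶜ = O := by
      ext x; simp only [mem_compl, mem_union, mem_sdiff, not_or, not_and, not_not, hW]
      constructor
      · rintro ⟨h1, h2⟩; exact h1 h2
      · intro hx; exact ⟨fun _ => hx, fun hxS => (mem_compl.1 (hOW hx)) hxS⟩
    rw [← reindex O hOW (fun Y => ∑ R' ∈ W.powerset, (if F.lab R' = 0 ∧ O ⊆ R' ∧ R' ⊆ Y then (1 : ZMod 2) else 0))]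
    refine Eq.trans (sum_congr rfl fun d' hd' => ?_) h
    unfold specRow
    simp only
    by_cases hSd' : S = d'.1
    · rw [if_pos hSd', if_pos hSd', ← hSd', if_pos hS0, h3, hW]
    · rw [if_neg hSd', if_neg hSd', mul_zero]
  · -- kernel spectator: `N`-columns (dual theorem)
    refine F.cross_kernel_trivial_dual W lam ?_ (d.1 ∪ d.2)ᶜ (mem_filter.2 ⟨mem_powerset.2 hYW, hY0, hY4, hXd.symm ▸ hX0, hXd.symm ▸ hX4, hXd.symm ▸ hlt⟩)
    intro O hO hO0 hO4
    have hOW := mem_powerset.1 hO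
    have hσ : (W \ O, S) ∈ F.sup := F.mk_mem_sup hOW (Or.inl hS4) hO0 hO4
    have h := hc _ hσ
    have h3 : ((W \ O) ∪ S)ᶜ = O := by
      ext x; simp only [mem_compl, mem_union, mem_sdiff, not_or, not_and, not_not, hW]
      constructor
      · rintro ⟨h1, h2⟩; exact h1 h2
      · intro hx; exact ⟨fun _ => hx, fun hxS => (mem_compl.1 (hOW hx)) hxS⟩
    have hS0 : F.lab S ≠ 0 := by rw [hS4]; decide
    rw [← reindex O hOW (fun Y => ∑ R ∈ W.powerset, (if F.lab R = 4 ∧ W \ Y ⊆ R ∧ R ⊆ W \ O then (1 : ZMod 2) else 0))]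
    refine Eq.trans (sum_congr rfl fun d' hd' => ?_) h
    unfold specRow
    simp only
    by_cases hSd' : S = d'.1
    · rw [if_pos hSd', if_pos hSd', ← hSd', if_neg hS0, h3, hW]
    · rw [if_neg hSd', if_neg hSd', mul_zero]

end Sunflower

end Summit.CriticalPhenomena.PercolationContinuityZ3.Theorems.SunflowerPartition
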